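import Mathlib.Analysis.Meromorphic.NormalForm
import Mathlib.Analysis.Complex.Convex
import Mathlib.Analysis.Convex.PathConnected
import Literature.NumberTheory.Automorphic.LanglandsTunnellBridge
import Literature.NumberTheory.GaloisRepresentations.ArtinLFunctionOrderAtOneProofs
import HarnessLib

/-!
# Artin's conjecture for `L(s, ρ)` implies that the completed `Λ(s, ρ)` is entire
# (given Artin's functional equation) — proofs only

A. R. Booker, *Poles of Artin L-functions and the strong Artin conjecture*, Ann. of Math. 158
(2003), p. 1091: "It is known, by nonvanishing results for Hecke `L`-functions [10], that
`L(s, ρ ⊗ χ)` is holomorphic in `Re s ≥ 1`, and by the functional equation, in `Re s ≤ 0`."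
This file proves the form of that remark which turns Artin's conjecture for the FINITE Artin
`L`-function `L(s, ρ)` (`LFunction.HasEntireContinuation (artinLFunction ρ)`, the hypothesis of
the named fact `booker_strongArtin_of_artinConjecture` of `Automorphic/BookerStrongArtin`) into
the entirety of the COMPLETED `Λ(s, ρ) = A(ρ)^{s/2} γ(ρ, s) L(s, ρ)` (`completedArtinLFunction`,
the hypothesis of the `F = ℚ` instance `bookerKrishnamurthy_isPiOfArtinRep_of_entire_twists.rat'`
of Booker–Krishnamurthy 2011, Cor. 1.2, `Automorphic/BookerKrishnamurthyConverseRatProofs`); the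
reduction of Booker's fact to Booker–Krishnamurthy's is `Automorphic/BookerStrongArtinReduction`.

* `hasEntireContinuation_completedArtinLFunction_of_hasEntireContinuation` (**main, proved**):
  for a framed Artin representation `ρ` of a number field satisfying Artin's functional equation
  against its contragredient `ρ^∨` (`ArtinRep.SatisfiesFunctionalEquation`, the clause of the
  named fact `artin_functional_equation`; Neukirch VII (12.6)) with `(ρ^∨)^{Γ_K} = 0`: `L(s, ρ)`
  entire ⇒ `Λ(s, ρ)` entire.  Proof: the meromorphic witness `Λ` of the functional equation
  agrees, off the closed negative real axis, with the holomorphic `A^{s/2} γ(ρ, s) g(s)` (`g` the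
  entire continuation of `L(s, ρ)`; identity principle on Mathlib's `Complex.slitPlane`, where
  `γ(ρ, s)` has no pole), so `Λ(s) = W Λ'(1 - s)` is only needed on the negative real axis —
  where `1 - s > 1` and `Λ'` is the (holomorphic) completed Euler product of `ρ^∨` — and at
  `s = 0`, where `Λ'` is regular at `1` because `L(s, ρ^∨) → c ≠ 0` as `s → 1⁺` (Heilbronn, in
  Cassels–Fröhlich, Ch. VIII §3: "regular and non-zero for `σ ≥ 1`"; the tree's discharged fact
  `artinLFunction_order_at_one_holds` with `(ρ^∨)^{Γ_K} = 0`).  A function meromorphic on `ℂ`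
  with non-negative order everywhere is entire after removal of its removable singularities
  (Mathlib `toMeromorphicNFOn`).  Neither the non-vanishing of `L(s, ρ^∨)` on the whole line
  `Re s = 1` nor any continuation of `L(s, ρ^∨)` beyond `Re s > 1` is used.
* `differentiableOn_artinLFunction` — the Artin Euler product is holomorphic on `re s > 1`
  (Neukirch VII §10, remark after (10.1)), from the tree's `M`-test for partial standard Euler
  products (`differentiableOn_partialStandardL_of_norm_le_one`) and the factorisation of the
  Artin Euler factors into unit-root polynomials
  (`ArtinRep.exists_eval_eulerFactorAt_eq_eval_eulerPolynomial`).
* `differentiableAt_gammaFactor_of_forall_ne_neg` — `γ(ρ, s)` is holomorphic off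
  `{0, -1, -2, …}` (the tree's `ArtinRep.differentiableOn_gammaFactor` is the case `re s > 0`).
* `hasEntireContinuation_gammaFactor_mul_artinLFunction_of_hasEntireContinuation` — the same
  conclusion for `Λ₀(s) = γ(ρ, s) L(s, ρ)` without the conductor power `A(ρ)^{s/2}` (an entire,
  nowhere-vanishing factor), the form of the hypothesis of
  `bookerKrishnamurthy_isPiOfArtinRep_of_entire_twists.rat`.
(The corollary for irreducible `σ` of dimension `≥ 2` — `(σ^∨)^{Γ_K} = 0` automatically — and the
reduction of Booker's fact are in `Automorphic/BookerStrongArtinReduction`.)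

Base field `K : Type` (universe `0`), forced by `partialStandardL`.  No definition and no named
fact is introduced (D-0026); theorems only.

## References

* A. R. Booker, Ann. of Math. (2) 158 (2003), 1089–1098: p. 1091. [Booker2003]
* H. Heilbronn, *Zeta-functions and L-functions*, in Cassels–Fröhlich (1967), Ch. VIII §3,
  Thm. 7 and the two paragraphs following it. [HeilbronnZetaL1967]
* J. Neukirch, *Algebraic Number Theory* (1999), VII §10 (10.1) and the remark following it,
  §12 (12.5)–(12.6). [NeukirchANT1999]
* J.-P. Serre, *Linear Representations of Finite Groups* (1977), §1.4 (d), §2.3.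
  [SerreLinearRepresentations1977]

## Mathlib / tree search

Mathlib (this pin): `Complex.slitPlane`, `Complex.starConvex_one_slitPlane`,
`StarConvex.isPathConnected`, `MeromorphicOn.meromorphicOrderAt_ne_top_of_isPreconnected`,
`tendsto_nhds_iff_meromorphicOrderAt_nonneg`, `toMeromorphicNFOn`,
`MeromorphicNFAt.meromorphicOrderAt_nonneg_iff_analyticAt`, `Complex.Gammaℝ_eq_zero_iff`.
Tree (`lean search` for `differentiableOn_artinLFunction`,
`hasEntireContinuation_completedArtinLFunction_of`,
`hasEntireContinuation_gammaFactor_mul_artinLFunction_of`): nothing before this file (the tree's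
`differentiableAt_gammaFactor` of `QuadraticFields/EpsteinZetaKroneckerLimit` concerns the
Epstein `Γ`-factor, in another namespace).
-/

noncomputable section

open scoped NumberField Topology
open Field IsDedekindDomain Module NumberField Filter Complex Set
open Literature.NumberTheory.GaloisRepresentations

namespace Literature.NumberTheory.Automorphic

universe w

/-! ### The Artin Euler product is holomorphic on `re s > 1` -/

section EulerProduct

variable {K : Type} [Field K] [NumberField K] {V : Type w} [AddCommGroup V] [Module ℂ V]
  [TopologicalSpace V] [FiniteDimensional ℂ V] [IsModuleTopology ℂ V]

/-- **The Artin Euler product is holomorphic on `re s > 1`** (Neukirch, *Algebraic Number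
Theory*, VII §10, remark after (10.1): "The Artin L-series converges absolutely and uniformly in
the half-plane `Re(s) ≥ 1 + δ` … It thus defines an analytic function"): the tree's
`artinLFunction ρ` (the `tprod` over all finite places) is complex-differentiable on `re s > 1`.
Proof: with `L_v(ρ, T) = ∏_{a ∈ α_v} (1 - a T)`, `|a| = 1`, `card α_v ≤ dim V`
(`ArtinRep.exists_eval_eulerFactorAt_eq_eval_eulerPolynomial`), `L(s, ρ)` is the partial standard
Euler product `L^∅(s, α)` of the family `α` (`partialStandardL`, reindexed along
`Equiv.subtypeUnivEquiv`), holomorphic there by the `M`-test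
(`differentiableOn_partialStandardL_of_norm_le_one`).
[cite: NeukirchANT1999, VII §10, remark after (10.1)] -/
theorem differentiableOn_artinLFunction (ρ : ArtinRep K V) :
    DifferentiableOn ℂ (artinLFunction ρ) {s : ℂ | 1 < s.re} := by
  choose α hcard hnorm hα using ρ.exists_eval_eulerFactorAt_eq_eval_eulerPolynomial
  have hLd : DifferentiableOn ℂ (partialStandardL (∅ : Set (HeightOneSpectrum (𝓞 K))) α)
      {s : ℂ | 1 < s.re} :=
    differentiableOn_partialStandardL_of_norm_le_one (S := ∅) (d := finrank ℂ V)
      (fun v _ a ha => (hnorm v a ha).le) (fun v _ => hcard v)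
  refine hLd.congr fun s _ => ?_
  unfold artinLFunction partialStandardL
  rw [← (Equiv.subtypeUnivEquiv
    (fun v : HeightOneSpectrum (𝓞 K) => Set.notMem_empty v)).tprod_eq]
  exact tprod_congr fun v => by rw [hα]; rfl

end EulerProduct

/-! ### The archimedean factor is holomorphic off the non-positive integers -/

section Gamma

variable {K : Type} [Field K] [NumberField K] {V : Type w} [AddCommGroup V] [Module ℂ V]
  [TopologicalSpace V]

/-- **`γ(ρ, s)` is holomorphic off `{0, -1, -2, …}`**: `γ(ρ, s)` is a finite product of powers
of `Γ_ℝ(s)`, `Γ_ℝ(s + 1)` and `Γ_ℂ(s) = Γ_ℝ(s) Γ_ℝ(s + 1)`, and `Γ_ℝ` is holomorphic wherever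
it is non-zero (`Complex.differentiableAt_Gammaℝ_of_ne_zero`), i.e. off `{0, -2, -4, …}`
(Mathlib `Complex.Gammaℝ_eq_zero_iff`).  Neukirch VII §12, (12.5); the tree's
`ArtinRep.differentiableOn_gammaFactor` is the case `re s > 0`.
[cite: NeukirchANT1999, VII §12, (12.5)] -/
theorem differentiableAt_gammaFactor_of_forall_ne_neg (ρ : ArtinRep K V) {s : ℂ}
    (hs : ∀ k : ℕ, s ≠ -k) : DifferentiableAt ℂ ρ.gammaFactor s := by
  classical
  have h0 : Gammaℝ s ≠ 0 := fun h => by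
    obtain ⟨m, hm⟩ := Gammaℝ_eq_zero_iff.mp h
    exact hs (2 * m) (by rw [hm]; push_cast; ring)
  have h1 : Gammaℝ (s + 1) ≠ 0 := fun h => by
    obtain ⟨m, hm⟩ := Gammaℝ_eq_zero_iff.mp h
    exact hs (2 * m + 1) (by push_cast; linear_combination hm)
  have hd0 : DifferentiableAt ℂ Gammaℝ s := differentiableAt_Gammaℝ_of_ne_zero h0
  have hd1 : DifferentiableAt ℂ (fun z : ℂ => Gammaℝ (z + 1)) s :=
    (differentiableAt_Gammaℝ_of_ne_zero h1).comp s (differentiableAt_id.add_const 1)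
  have hdC : DifferentiableAt ℂ Gammaℂ s := by
    have h1' : (fun z : ℂ => Gammaℝ z * Gammaℝ (z + 1)) = Gammaℂ :=
      funext Gammaℝ_mul_Gammaℝ_add_one
    rw [← h1']
    exact hd0.mul hd1
  unfold ArtinRep.gammaFactor
  refine DifferentiableAt.fun_finsetProd fun w _ => ?_
  by_cases hw : w.IsReal
  · simp only [hw, ↓reduceDIte]
    exact (hd0.pow _).mul (hd1.pow _)
  · simp only [hw, ↓reduceDIte]
    exact hdC.pow _

end Gamma

/-! ### Entirety of the completed Artin `L`-function from Artin's conjecture and the FE -/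

section Completed

variable {K : Type} [Field K] [NumberField K]

/-- **Identity principle for a meromorphic function on a preconnected set**: if `N` is
meromorphic on the preconnected set `U` and vanishes on a neighbourhood of a point of `U`, then
it vanishes on a punctured neighbourhood of every point of `U` (Mathlib
`MeromorphicOn.meromorphicOrderAt_ne_top_of_isPreconnected`; pointwise vanishing does not follow
for Mathlib's `MeromorphicAt`).  The tree's `LFunctions.eventuallyEq_zero_of_eqOn_halfPlane` is
the case of a right half-plane. [folklore] -/
theorem eventuallyEq_zero_nhdsNE_of_isPreconnected {U : Set ℂ} (hU : IsPreconnected U)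
    {N : ℂ → ℂ} (hN : MeromorphicOn N U) {x₀ : ℂ} (hx₀ : x₀ ∈ U) (h0 : N =ᶠ[𝓝 x₀] 0)
    {x : ℂ} (hx : x ∈ U) : N =ᶠ[𝓝[≠] x] 0 := by
  have h₁ : meromorphicOrderAt N x₀ = ⊤ :=
    meromorphicOrderAt_eq_top_iff.2 (h0.filter_mono nhdsWithin_le_nhds)
  have htop : meromorphicOrderAt N x = ⊤ := by
    by_contra hne
    exact hN.meromorphicOrderAt_ne_top_of_isPreconnected hU hx hx₀ hne h₁
  exact meromorphicOrderAt_eq_top_iff.1 htop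

/-- **Artin's conjecture for `L(s, ρ)` implies that the completed `Λ(s, ρ)` is entire, given
Artin's functional equation** (the remark of Booker 2003, p. 1091: `L(s, ρ)` "is holomorphic
in `Re s ≥ 1` [Heilbronn], and by the functional equation, in `Re s ≤ 0`", in the amount needed
for the completed function).  Let `ρ : Γ_K → GL_n(ℂ)` be a framed Artin representation of the
number field `K` such that (i) `ρ` and its contragredient `ρ^∨` satisfy Artin's functional
equation (`ArtinRep.SatisfiesFunctionalEquation`: meromorphic `Λ, Λ'` on `ℂ` continuing
`Λ(s, ρ) = A^{s/2} γ(ρ, s) L(s, ρ)` and `Λ(s, ρ^∨)` from `re s > 1`, with `Λ(1 - s) = W Λ'(s)`;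
Neukirch VII (12.6)), (ii) `(ρ^∨)^{Γ_K} = 0`, and (iii) `L(s, ρ)` has an entire continuation
`g`.  Then `Λ(s, ρ)` (`completedArtinLFunction`) has an entire continuation.  Proof: `Λ` agrees
with the holomorphic `A^{s/2} γ(ρ, s) g(s)` on punctured neighbourhoods of every point off the
closed negative real axis (identity principle on the slit plane, where `γ(ρ, ·)` has no pole,
`differentiableAt_gammaFactor_of_forall_ne_neg`); on the negative real axis
`Λ(s) = W Λ'(1 - s)` with `1 - s > 1`, where `Λ'` is the holomorphic completed Euler product of
`ρ^∨` (`differentiableOn_artinLFunction`); and at `s = 0`, `Λ'` has order `0` at `1` because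
`L(s, ρ^∨) → c ≠ 0` as `s → 1⁺` (Heilbronn: `artinLFunction_order_at_one_holds`,
`artinLFunction_tendsto_ne_zero_of_invariants_eq_bot`) and `A^{1/2} γ(ρ^∨, 1) ≠ 0`.  So `Λ` has
non-negative meromorphic order everywhere, and its normal form (`toMeromorphicNFOn`) is an entire
function agreeing with `Λ(s, ρ)` on `re s > 1`. [cite: Booker2003, p. 1091]
[cite: HeilbronnZetaL1967, Ch. VIII §3, Thm. 7 and the two paragraphs following it]
[cite: NeukirchANT1999, VII §12, Thm. (12.6)] -/
theorem hasEntireContinuation_completedArtinLFunction_of_hasEntireContinuation {n : ℕ}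
    (ρ : FramedArtinRep K n)
    (hFE : ρ.toArtinRep.SatisfiesFunctionalEquation
      (FramedArtinRep.toArtinRep (FramedRep.dual ρ)))
    (hinv : (FramedArtinRep.toArtinRep (FramedRep.dual ρ)).invariants = ⊥)
    (hL : LFunction.HasEntireContinuation (artinLFunction ρ.toArtinRep)) :
    LFunction.HasEntireContinuation (completedArtinLFunction ρ.toArtinRep) := by
  obtain ⟨g, hg, hgL⟩ := hL
  obtain ⟨Λ, Λ', hΛ, hΛ', hagree, W, -, hW⟩ := hFE
  obtain ⟨hΦd, γinv, -, hΦinv⟩ := ρ.toArtinRep.exists_differentiable_mul_completedFactor_eq_one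
  obtain ⟨hΦ'd, γinv', -, hΦ'inv⟩ :=
    (FramedArtinRep.toArtinRep (FramedRep.dual ρ)).exists_differentiable_mul_completedFactor_eq_one
  set ρ' : ArtinRep K (Fin n → ℂ) := FramedArtinRep.toArtinRep (FramedRep.dual ρ) with hρ'
  set Φ : ℂ → ℂ := fun s => (ρ.toArtinRep.artinConductorNorm : ℂ) ^ (s / 2) *
    ρ.toArtinRep.gammaFactor s with hΦ
  set Φ' : ℂ → ℂ := fun s => (ρ'.artinConductorNorm : ℂ) ^ (s / 2) * ρ'.gammaFactor s with hΦ'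
  have hA : (ρ.toArtinRep.artinConductorNorm : ℂ) ≠ 0 :=
    Nat.cast_ne_zero.2 ρ.toArtinRep.artinConductorNorm_ne_zero'
  have hopen1 : IsOpen {s : ℂ | 1 < s.re} := isOpen_lt continuous_const continuous_re
  have hopen0 : IsOpen {s : ℂ | 0 < s.re} := isOpen_lt continuous_const continuous_re
  -- the functional equation, read at `1 - w`
  have hFE' : ∀ w, Λ w = W * Λ' (1 - w) := fun w => by simpa using hW (1 - w)
  -- a limit of `Λ'` at `1 - z` gives non-negative order of `Λ` at `z`
  have htrans : ∀ z : ℂ, (∃ c, Tendsto Λ' (𝓝[≠] (1 - z)) (𝓝 c)) →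
      0 ≤ meromorphicOrderAt Λ z := by
    rintro z ⟨c, hc⟩
    refine (tendsto_nhds_iff_meromorphicOrderAt_nonneg (hΛ z)).1 ⟨W * c, ?_⟩
    have h1 : Tendsto (fun w => W * Λ' (1 - w)) (𝓝[≠] z) (𝓝 (W * c)) :=
      (hc.comp (LFunctions.tendsto_one_sub_nhdsNE z)).const_mul W
    exact h1.congr fun w => (hFE' w).symm
  /- Step I: off the closed negative real axis, `Λ` agrees puncturedly with the holomorphic
  function `Λ₁ = Φ g`. -/
  have hΦat : ∀ s : ℂ, (∀ k : ℕ, s ≠ -k) → DifferentiableAt ℂ Φ s := fun s hs =>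
    (DifferentiableAt.const_cpow (differentiableAt_id.div_const 2) (Or.inl hA)).mul
      (differentiableAt_gammaFactor_of_forall_ne_neg ρ.toArtinRep hs)
  have hΦslit : DifferentiableOn ℂ Φ slitPlane := by
    intro s hs
    refine (hΦat s fun k hk => ?_).differentiableWithinAt
    subst hk
    rw [mem_slitPlane_iff] at hs
    simp only [neg_re, natCast_re, Left.neg_pos_iff, neg_im, natCast_im, neg_zero, ne_eq,
      not_true_eq_false, or_false] at hs
    exact lt_irrefl _ (hs.trans_le (Nat.cast_nonneg k))
  set Λ₁ : ℂ → ℂ := fun s => Φ s * g s with hΛ₁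
  have hΛ₁an : AnalyticOnNhd ℂ Λ₁ slitPlane :=
    (hΦslit.mul hg.differentiableOn).analyticOnNhd isOpen_slitPlane
  have hN : MeromorphicOn (Λ - Λ₁) slitPlane := hΛ.meromorphicOn.sub hΛ₁an.meromorphicOn
  have h2 : (Λ - Λ₁) =ᶠ[𝓝 (2 : ℂ)] 0 := by
    have hmem : {s : ℂ | 1 < s.re} ∈ 𝓝 (2 : ℂ) := hopen1.mem_nhds (by norm_num)
    filter_upwards [hmem] with s hs
    have hs' : 1 < s.re := hs
    simp only [Pi.sub_apply, Pi.zero_apply, hΛ₁, hΦ, (hagree s hs').1, hgL s hs',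
      completedArtinLFunction, sub_self]
  have h2mem : (2 : ℂ) ∈ slitPlane := Or.inl (by norm_num)
  have hI : ∀ z ∈ slitPlane, Λ =ᶠ[𝓝[≠] z] Λ₁ := fun z hz => by
    have h1mem : (1 : ℂ) ∈ slitPlane := Or.inl (by norm_num)
    have hpc : IsPreconnected slitPlane :=
      (starConvex_one_slitPlane.isPathConnected h1mem).isConnected.isPreconnected
    have h := eventuallyEq_zero_nhdsNE_of_isPreconnected hpc hN h2mem h2 hz
    filter_upwards [h] with w hw
    exact sub_eq_zero.mp hw
  have hordI : ∀ z ∈ slitPlane, 0 ≤ meromorphicOrderAt Λ z := fun z hz => by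
    rw [meromorphicOrderAt_congr (hI z hz)]
    exact (hΛ₁an z hz).meromorphicOrderAt_nonneg
  /- Step II: at `z` with `re (1 - z) > 1`, where `Λ'` is the completed Euler product of `ρ^∨`. -/
  have hΛ'₁d : DifferentiableOn ℂ (completedArtinLFunction ρ') {s : ℂ | 1 < s.re} := by
    have hsub : {s : ℂ | 1 < s.re} ⊆ {s : ℂ | 0 < s.re} := fun s (hs : 1 < s.re) =>
      show 0 < s.re from lt_trans zero_lt_one hs
    exact (hΦ'd.mono hsub).mul (differentiableOn_artinLFunction ρ')
  have hII : ∀ w : ℂ, 1 < w.re → AnalyticAt ℂ Λ' w := fun w hw => by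
    have han : AnalyticAt ℂ (completedArtinLFunction ρ') w := hΛ'₁d.analyticOnNhd hopen1 w hw
    refine han.congr ?_
    filter_upwards [hopen1.mem_nhds hw] with s hs
    exact ((hagree s hs).2).symm
  have hordII : ∀ z : ℂ, 1 < (1 - z).re → 0 ≤ meromorphicOrderAt Λ z := fun z hz =>
    htrans z ⟨_, (hII (1 - z) hz).continuousAt.tendsto.mono_left nhdsWithin_le_nhds⟩
  /- Step III: at `z = 0`, where `Λ'` is regular (of order `0`) at `1`. -/
  have hordIII : 0 ≤ meromorphicOrderAt Λ 0 := by
    apply htrans 0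
    rw [sub_zero]
    obtain ⟨c, hc, hlim⟩ := artinLFunction_tendsto_ne_zero_of_invariants_eq_bot
      artinLFunction_order_at_one_holds ρ' hinv
    have h1mem : {s : ℂ | 0 < s.re} ∈ 𝓝 (1 : ℂ) := hopen0.mem_nhds (by norm_num)
    have hΦ'1 : ContinuousAt Φ' 1 := (hΦ'd.differentiableAt h1mem).continuousAt
    have hΦ'ne : Φ' 1 ≠ 0 := fun h0 => by
      have h11 : Φ' 1 * γinv' 1 = 1 := hΦ'inv 1 (by norm_num)
      rw [h0, zero_mul] at h11
      exact zero_ne_one h11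
    have hlimΛ' : Tendsto Λ' (𝓝[{s : ℂ | 1 < s.re}] 1) (𝓝 (Φ' 1 * c)) := by
      have hprod := (hΦ'1.tendsto.mono_left nhdsWithin_le_nhds).mul hlim
      refine hprod.congr' ?_
      filter_upwards [self_mem_nhdsWithin] with s hs
      have hs' : 1 < s.re := hs
      simp only [hΦ', (hagree s hs').2, completedArtinLFunction]
    haveI := neBot_nhdsWithin_one_lt_re
    have hord : meromorphicOrderAt Λ' 1 = -((0 : ℕ) : ℤ) :=
      meromorphicOrderAt_eq_neg_of_tendsto nhdsWithin_one_lt_re_le_nhdsNE (hΛ' 1)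
        (mul_ne_zero hΦ'ne hc) (by simpa using hlimΛ')
    have h0 : 0 ≤ meromorphicOrderAt Λ' 1 := by
      rw [hord]
      simp
    exact tendsto_nhds_of_meromorphicOrderAt_nonneg (hΛ' 1) h0
  /- Step IV: `Λ` has non-negative order everywhere. -/
  have hord : ∀ z : ℂ, 0 ≤ meromorphicOrderAt Λ z := fun z => by
    by_cases hz : z ∈ slitPlane
    · exact hordI z hz
    · rw [mem_slitPlane_iff, not_or, not_lt, not_ne_iff] at hz
      obtain ⟨hre, him⟩ := hz
      rcases hre.lt_or_eq with hlt | heq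
      · exact hordII z (by simp only [sub_re, one_re]; linarith)
      · have hz0 : z = 0 := Complex.ext (by simpa using heq) (by simpa using him)
        rw [hz0]
        exact hordIII
  /- Step V: remove the (removable) singularities of the meromorphic witness. -/
  have hΛon : MeromorphicOn Λ Set.univ := hΛ.meromorphicOn
  set G : ℂ → ℂ := toMeromorphicNFOn Λ Set.univ with hG
  have hGNF : MeromorphicNFOn G Set.univ := meromorphicNFOn_toMeromorphicNFOn Λ Set.univ
  have hGan : ∀ z, AnalyticAt ℂ G z := fun z => by
    have hz : z ∈ Set.univ := Set.mem_univ z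
    apply (hGNF hz).meromorphicOrderAt_nonneg_iff_analyticAt.1
    rw [meromorphicOrderAt_toMeromorphicNFOn hΛon hz]
    exact hord z
  refine ⟨G, fun z => (hGan z).differentiableAt, fun s hs => ?_⟩
  have hs' : s ∈ slitPlane := Or.inl (lt_trans zero_lt_one hs)
  have h1 : G =ᶠ[𝓝[≠] s] Λ₁ :=
    (hΛon.toMeromorphicNFOn_eq_self_on_nhdsNE (Set.mem_univ s)).trans (hI s hs')
  have h2 : G =ᶠ[𝓝 s] Λ₁ :=
    ((hGan s).continuousAt.eventuallyEq_nhds_iff_eventuallyEq_nhdsNE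
      (hΛ₁an s hs').continuousAt).1 h1
  rw [h2.eq_of_nhds]
  simp only [hΛ₁, hΦ, hgL s hs, completedArtinLFunction]

/-- **The same conclusion for `Λ₀(s) = γ(ρ, s) L(s, ρ)`** (no conductor power): under the
hypotheses of `hasEntireContinuation_completedArtinLFunction_of_hasEntireContinuation`,
`γ(ρ, s) L(s, ρ)` has an entire continuation, namely `A(ρ)^{-s/2}` times that of
`Λ(s, ρ) = A(ρ)^{s/2} γ(ρ, s) L(s, ρ)` — `A(ρ) ≠ 0` (`ArtinRep.artinConductorNorm_ne_zero'`), so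
`A(ρ)^{-s/2} = (exp((s/2) log A(ρ)))⁻¹` is entire (Neukirch VII (12.2): the constant
`c(L|K, χ)^{s/2}` of `Λ`).  This is the form of the hypothesis of
`bookerKrishnamurthy_isPiOfArtinRep_of_entire_twists.rat`. [cite: NeukirchANT1999, VII §12, (12.2)]
[cite: Booker2003, p. 1091] -/
theorem hasEntireContinuation_gammaFactor_mul_artinLFunction_of_hasEntireContinuation {n : ℕ}
    (ρ : FramedArtinRep K n)
    (hFE : ρ.toArtinRep.SatisfiesFunctionalEquation
      (FramedArtinRep.toArtinRep (FramedRep.dual ρ)))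
    (hinv : (FramedArtinRep.toArtinRep (FramedRep.dual ρ)).invariants = ⊥)
    (hL : LFunction.HasEntireContinuation (artinLFunction ρ.toArtinRep)) :
    LFunction.HasEntireContinuation
      fun s => ρ.toArtinRep.gammaFactor s * artinLFunction ρ.toArtinRep s := by
  obtain ⟨G, hG, hGL⟩ :=
    hasEntireContinuation_completedArtinLFunction_of_hasEntireContinuation ρ hFE hinv hL
  have hA : (ρ.toArtinRep.artinConductorNorm : ℂ) ≠ 0 :=
    Nat.cast_ne_zero.2 ρ.toArtinRep.artinConductorNorm_ne_zero'
  set E : ℂ → ℂ := fun s => (ρ.toArtinRep.artinConductorNorm : ℂ) ^ (s / 2) with hEdef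
  have hE : Differentiable ℂ E := fun s =>
    DifferentiableAt.const_cpow (differentiableAt_id.div_const 2) (Or.inl hA)
  have hE0 : ∀ s, E s ≠ 0 := fun s => cpow_ne_zero_iff.mpr (Or.inl hA)
  refine ⟨fun s => (E s)⁻¹ * G s, (hE.inv hE0).mul hG, fun s hs => ?_⟩
  have hΛ : completedArtinLFunction ρ.toArtinRep s =
      E s * (ρ.toArtinRep.gammaFactor s * artinLFunction ρ.toArtinRep s) := by
    rw [completedArtinLFunction, mul_assoc]
  simp only [hGL s hs, hΛ, ← mul_assoc, inv_mul_cancel₀ (hE0 s), one_mul]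

end Completed

end Literature.NumberTheory.Automorphic

end
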